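import Summits.NavierStokesRegularity.NavierStokesRegularity.Theorems.FilamentSkeletonRssCoreLinearInvertibilityOddSymmetrizerBoundsPotential
import Summits.NavierStokesRegularity.NavierStokesRegularity.Theorems.FilamentSkeletonRssCoreLinearInvertibilityClassClosureToolsB
import Summits.AnomalousDissipation.AnomalousDissipation.Theorems.MarginalStabilityChainStretchedVortexRowsStubBiotSavartYoung

/-!
# Crux `CoreLinearInvertibility` (stmt-NavierStokesRegularity-17973), line `Sketch`:
# tools for stub `stub_oddSymmetrizerBounds` — weighted `L²` control of `ψ = N ∗ w` and `∇ψ` by `‖w‖_{X_λ}`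

Helper file (theorems only; lands `--supports stmt-NavierStokesRegularity-17973`, ends with the
registered sub-stub `stub_oddSymmetrizerBoundsToolsD`) for the stub `stub_oddSymmetrizerBounds` of
the skeleton `Cruxes/CoreLinearInvertibility/Lines/Sketch.lean`.  The estimate `‖L_λ u‖ ≤ C‖w‖`
(`u = Φ(|x|)ψ`) reduces to bounds of `∫ m ψ²` and `∫ m |∇ψ|²` for a bounded integrable Gaussian-type
weight `m`, in terms of `‖w‖²_{X_λ} = ∫ G_λ⁻¹ w²` (`X_λ = L²(G_λ⁻¹dx)`):

* `X_λ` controls `‖w‖₁² ≤ ‖w‖²_{X_λ}` (`∫ G_λ = 1`), `(∫ |y||w|)² ≤ (∫|y|²G_λ) ‖w‖²_{X_λ}` and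
  `‖w‖₂² ≤ (1−λ)/(4π) ‖w‖²_{X_λ}` (weighted Cauchy–Schwarz of `…ClassClosureToolsA/B`);
* the pointwise bound `|ψ(x)| ≤ (2π)⁻¹ (A(x) + log(1+|x|) ‖w‖₁ + ∫|y||w|)` with
  `A = L₀ ∗ |w|`, `L₀ = 𝟙_{|z|<1}(−log|z|) ∈ L¹`, and `A² ≤ ‖L₀‖₁ (L₀ ∗ w²)` (Cauchy–Schwarz), whence
  `∫ m ψ² ≤ 3(2π)⁻² (‖L₀‖₁² H ‖w‖₂² + ‖w‖₁² ∫ m(1+|x|)² + (∫|y||w|)² ∫ m)` for `0 ≤ m ≤ H`;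
* `∫ m |∇ψ|² = ∫ m |K∗w|²` (tools A: `K ∗ w = (∇ψ)^⊥`) is bounded by the Young-type inequality of
  `Summits.AnomalousDissipation.….StubBiotSavartYoung` with `h = √m`.

References: Th. Gallay, C. E. Wayne, Comm. Math. Phys. 255 (2005) §1 and J. Math. Fluid Mech. 9
(2007) (1.3) (planar Biot–Savart and logarithmic potential); folklore.
-/

set_option linter.dupNamespace false

noncomputable section

namespace Summit.NavierStokesRegularity.NavierStokesRegularity.Theorems

open MeasureTheory Filter Topology Set Function Metric
open Literature.Analysis.FluidPDE
open Summit.AnomalousDissipation.AnomalousDissipation.Theorems.MarginalStabilityChainStretchedVortexRows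
open scoped InnerProductSpace Laplacian ContDiff

/-! ### `X_λ` controls the `L¹`-type norms -/

section XNorm

variable {lam : ℝ} (hlam : lam < 1) {w : EuclideanSpace ℝ (Fin 2) → ℝ} (hw : Continuous w)
  (hwX : Integrable (fun x => (gaussWeightLam lam x)⁻¹ * w x ^ 2))

include hlam hw hwX in
/-- **`‖w‖₁² ≤ ‖w‖²_{X_λ}`** (`∫ |w| = ∫ G_λ⁻¹ · G_λ · |w|`, Cauchy–Schwarz, `∫ G_λ = 1`). [folklore] -/
theorem oddSym_sq_integral_abs_le :
    (∫ x, |w x|) ^ 2 ≤ ∫ x, (gaussWeightLam lam x)⁻¹ * w x ^ 2 := by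
  have hg0 : ∀ x, 0 ≤ (gaussWeightLam lam x)⁻¹ := fun x => (inv_pos.2 (gaussWeightLam_pos hlam x)).le
  have hga : Integrable (fun x => (gaussWeightLam lam x)⁻¹ * gaussWeightLam lam x ^ 2) := by
    refine (integrable_gaussWeightLam hlam).congr (Eventually.of_forall fun x => ?_)
    have := (gaussWeightLam_pos hlam x).ne'
    field_simp
  have hgb : Integrable (fun x => (gaussWeightLam lam x)⁻¹ * |w x| ^ 2) := by simpa only [sq_abs] using hwX
  obtain ⟨-, hcs⟩ := abs_integral_weight_mul_mul_le (μ := volume) (a := gaussWeightLam lam) (b := fun x => |w x|) hg0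
    (continuous_inv_gaussWeightLam hlam).aestronglyMeasurable (continuous_gaussWeightLam lam).aestronglyMeasurable
    (continuous_abs.comp hw).aestronglyMeasurable hga hgb
  have h1 : ∫ x, (gaussWeightLam lam x)⁻¹ * (gaussWeightLam lam x * |w x|) = ∫ x, |w x| :=
    integral_congr_ae (Eventually.of_forall fun x => by
      have := (gaussWeightLam_pos hlam x).ne'
      field_simp)
  have h2 : ∫ x, (gaussWeightLam lam x)⁻¹ * gaussWeightLam lam x ^ 2 = 1 := by
    rw [← integral_gaussWeightLam hlam]
    exact integral_congr_ae (Eventually.of_forall fun x => by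
      have := (gaussWeightLam_pos hlam x).ne'
      field_simp)
  rw [h1, h2, Real.sqrt_one, one_mul] at hcs
  simp only [sq_abs] at hcs
  have h0 : 0 ≤ ∫ x, |w x| := integral_nonneg fun x => abs_nonneg _
  rw [abs_of_nonneg h0] at hcs
  have hS : 0 ≤ ∫ x, (gaussWeightLam lam x)⁻¹ * w x ^ 2 := integral_nonneg fun x => mul_nonneg (hg0 x) (sq_nonneg _)
  calc (∫ x, |w x|) ^ 2 ≤ (Real.sqrt (∫ x, (gaussWeightLam lam x)⁻¹ * w x ^ 2)) ^ 2 :=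
        pow_le_pow_left₀ h0 hcs 2
    _ = _ := Real.sq_sqrt hS

include hlam hw hwX in
/-- **`(∫ |y| |w|)² ≤ (∫ |y|² G_λ) ‖w‖²_{X_λ}`** (Cauchy–Schwarz with `|y| |w| = G_λ⁻¹ · (|y| G_λ) · |w|`). [folklore] -/
theorem oddSym_sq_integral_norm_mul_abs_le :
    (∫ x, ‖x‖ * |w x|) ^ 2 ≤ (∫ x : EuclideanSpace ℝ (Fin 2), ‖x‖ ^ 2 * gaussWeightLam lam x) *
      ∫ x, (gaussWeightLam lam x)⁻¹ * w x ^ 2 := by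
  have hg0 : ∀ x, 0 ≤ (gaussWeightLam lam x)⁻¹ := fun x => (inv_pos.2 (gaussWeightLam_pos hlam x)).le
  have hga : Integrable (fun x => (gaussWeightLam lam x)⁻¹ * (‖x‖ * gaussWeightLam lam x) ^ 2) := by
    refine (integrable_norm_sq_mul_gaussWeightLam hlam).congr (Eventually.of_forall fun x => ?_)
    have := (gaussWeightLam_pos hlam x).ne'
    field_simp
  have hgb : Integrable (fun x => (gaussWeightLam lam x)⁻¹ * |w x| ^ 2) := by simpa only [sq_abs] using hwX
  obtain ⟨-, hcs⟩ := abs_integral_weight_mul_mul_le (μ := volume) (a := fun x => ‖x‖ * gaussWeightLam lam x)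
    (b := fun x => |w x|) hg0 (continuous_inv_gaussWeightLam hlam).aestronglyMeasurable
    (continuous_norm.mul (continuous_gaussWeightLam lam)).aestronglyMeasurable
    (continuous_abs.comp hw).aestronglyMeasurable hga hgb
  have h1 : ∫ x, (gaussWeightLam lam x)⁻¹ * (‖x‖ * gaussWeightLam lam x * |w x|) = ∫ x, ‖x‖ * |w x| :=
    integral_congr_ae (Eventually.of_forall fun x => by
      have := (gaussWeightLam_pos hlam x).ne'
      field_simp)
  have h2 : ∫ x, (gaussWeightLam lam x)⁻¹ * (‖x‖ * gaussWeightLam lam x) ^ 2 =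
      ∫ x : EuclideanSpace ℝ (Fin 2), ‖x‖ ^ 2 * gaussWeightLam lam x :=
    integral_congr_ae (Eventually.of_forall fun x => by
      have := (gaussWeightLam_pos hlam x).ne'
      field_simp)
  rw [h1, h2] at hcs
  simp only [sq_abs] at hcs
  have h0 : 0 ≤ ∫ x, ‖x‖ * |w x| := integral_nonneg fun x => mul_nonneg (norm_nonneg _) (abs_nonneg _)
  rw [abs_of_nonneg h0] at hcs
  have hS : 0 ≤ ∫ x, (gaussWeightLam lam x)⁻¹ * w x ^ 2 := integral_nonneg fun x => mul_nonneg (hg0 x) (sq_nonneg _)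
  have hM : 0 ≤ ∫ x : EuclideanSpace ℝ (Fin 2), ‖x‖ ^ 2 * gaussWeightLam lam x :=
    integral_nonneg fun x => mul_nonneg (sq_nonneg _) (gaussWeightLam_pos hlam x).le
  calc (∫ x, ‖x‖ * |w x|) ^ 2 ≤ (Real.sqrt (∫ x : EuclideanSpace ℝ (Fin 2), ‖x‖ ^ 2 * gaussWeightLam lam x) *
        Real.sqrt (∫ x, (gaussWeightLam lam x)⁻¹ * w x ^ 2)) ^ 2 := pow_le_pow_left₀ h0 hcs 2
    _ = _ := by rw [mul_pow, Real.sq_sqrt hS, Real.sq_sqrt hM]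

include hlam in
/-- **`‖w‖₂² ≤ (1−λ)/(4π) ‖w‖²_{X_λ}`** (`w² = G_λ · G_λ⁻¹ w²`, `G_λ ≤ (1−λ)/(4π)`). [folklore] -/
theorem oddSym_integral_sq_le (hw2 : Integrable fun x => w x ^ 2)
    (hwX : Integrable (fun x => (gaussWeightLam lam x)⁻¹ * w x ^ 2)) :
    ∫ x, w x ^ 2 ≤ (1 - lam) / (4 * Real.pi) * ∫ x, (gaussWeightLam lam x)⁻¹ * w x ^ 2 := by
  rw [← integral_const_mul]
  refine integral_mono hw2 (hwX.const_mul _) fun x => ?_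
  have hG := gaussWeightLam_pos hlam x
  calc w x ^ 2 = gaussWeightLam lam x * ((gaussWeightLam lam x)⁻¹ * w x ^ 2) := by field_simp
    _ ≤ (1 - lam) / (4 * Real.pi) * ((gaussWeightLam lam x)⁻¹ * w x ^ 2) :=
        mul_le_mul_of_nonneg_right (gaussWeightLam_le hlam x) (mul_nonneg (inv_pos.2 hG).le (sq_nonneg _))

end XNorm

/-! ### Pointwise control of `ψ = N ∗ w` -/

section PsiPointwise

variable {w ψ : EuclideanSpace ℝ (Fin 2) → ℝ} (hw : Continuous w) (hwc : HasCompactSupport w)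
  (hψ : ∀ x, ψ x = ∫ y, (2 * Real.pi)⁻¹ * Real.log ‖x - y‖ * w y)

include hw hwc in
/-- `L₀(x − ·) |w|` and `L₀(x − ·) w²` are integrable (`L₀ = 𝟙_{|z|<1}(−log|z|) ∈ L¹`, `w` bounded). [folklore] -/
theorem oddSym_integrable_logLoc_mul (x : EuclideanSpace ℝ (Fin 2)) :
    Integrable (fun y => (ball (0 : EuclideanSpace ℝ (Fin 2)) 1).indicator (fun z => -Real.log ‖z‖) (x - y) * |w y|) ∧
    Integrable (fun y => w y ^ 2 * (ball (0 : EuclideanSpace ℝ (Fin 2)) 1).indicator (fun z => -Real.log ‖z‖) (x - y)) := by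
  obtain ⟨M, hM⟩ := hw.bounded_above_of_compact_support hwc
  have hL : Integrable fun y => (ball (0 : EuclideanSpace ℝ (Fin 2)) 1).indicator (fun z => -Real.log ‖z‖) (x - y) :=
    integrable_indicator_neg_log_norm.comp_sub_left x
  refine ⟨?_, ?_⟩
  · have := hL.bdd_mul (c := M) (f := fun y => |w y|) (continuous_abs.comp hw).aestronglyMeasurable
      (Eventually.of_forall fun y => by rw [Real.norm_eq_abs, abs_abs, ← Real.norm_eq_abs]; exact hM y)
    exact this.congr (Eventually.of_forall fun y => mul_comm _ _)
  · exact hL.bdd_mul (c := M ^ 2) (f := fun y => w y ^ 2) (hw.pow 2).aestronglyMeasurable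
      (Eventually.of_forall fun y => by
        rw [Real.norm_eq_abs, abs_pow, ← Real.norm_eq_abs]
        exact pow_le_pow_left₀ (norm_nonneg _) (hM y) 2)

include hw hwc hψ in
/-- **Pointwise bound of the logarithmic potential**:
`|ψ(x)| ≤ (2π)⁻¹ ((L₀ ∗ |w|)(x) + log(1+|x|) ‖w‖₁ + ∫ |y||w(y)| dy)`
(`|log|x − y|| ≤ L₀(x−y) + log(1+|x|) + |y|`). [folklore] -/
theorem oddSym_abs_psi_le (x : EuclideanSpace ℝ (Fin 2)) :
    |ψ x| ≤ (2 * Real.pi)⁻¹ *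
      ((∫ y, (ball (0 : EuclideanSpace ℝ (Fin 2)) 1).indicator (fun z => -Real.log ‖z‖) (x - y) * |w y|) +
        Real.log (1 + ‖x‖) * (∫ y, |w y|) + ∫ y, ‖y‖ * |w y|) := by
  have hc : (0:ℝ) ≤ (2 * Real.pi)⁻¹ := by positivity
  have hi0 := (oddSym_integrable_logLoc_mul hw hwc x).1
  have hi1 : Integrable fun y => |w y| := (continuous_abs.comp hw).integrable_of_hasCompactSupport hwc.norm
  have hi2 : Integrable fun y => ‖y‖ * |w y| :=
    (continuous_norm.mul (continuous_abs.comp hw)).integrable_of_hasCompactSupport hwc.norm.mul_left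
  set F : EuclideanSpace ℝ (Fin 2) → ℝ := fun y => (2 * Real.pi)⁻¹ *
    ((ball (0 : EuclideanSpace ℝ (Fin 2)) 1).indicator (fun z => -Real.log ‖z‖) (x - y) * |w y| +
      Real.log (1 + ‖x‖) * |w y| + ‖y‖ * |w y|) with hF
  have hi1' : Integrable fun y => Real.log (1 + ‖x‖) * |w y| := hi1.const_mul _
  have hi01 : Integrable fun y => (ball (0 : EuclideanSpace ℝ (Fin 2)) 1).indicator (fun z => -Real.log ‖z‖) (x - y) * |w y| +
      Real.log (1 + ‖x‖) * |w y| := hi0.add hi1'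
  have hFint : Integrable F := (hi01.add hi2).const_mul _
  have hFI : ∫ y, F y = (2 * Real.pi)⁻¹ *
      ((∫ y, (ball (0 : EuclideanSpace ℝ (Fin 2)) 1).indicator (fun z => -Real.log ‖z‖) (x - y) * |w y|) +
        Real.log (1 + ‖x‖) * (∫ y, |w y|) + ∫ y, ‖y‖ * |w y|) := by
    simp only [hF]
    rw [integral_const_mul, integral_add hi01 hi2, integral_add hi0 hi1', integral_const_mul]
  rw [hψ x, ← Real.norm_eq_abs, ← hFI]
  refine norm_integral_le_of_norm_le hFint (Eventually.of_forall fun y => ?_)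
  rw [Real.norm_eq_abs, abs_mul, abs_mul, abs_of_nonneg hc, mul_assoc]
  refine mul_le_mul_of_nonneg_left ?_ hc
  have h1 := abs_log_norm_sub_le x y
  calc |Real.log ‖x - y‖| * |w y|
      ≤ ((ball (0 : EuclideanSpace ℝ (Fin 2)) 1).indicator (fun z => -Real.log ‖z‖) (x - y) +
          Real.log (1 + ‖x‖) + ‖y‖) * |w y| := mul_le_mul_of_nonneg_right h1 (abs_nonneg _)
    _ = _ := by ring

include hw hwc in
/-- **Cauchy–Schwarz for the local part**: `((L₀ ∗ |w|)(x))² ≤ ‖L₀‖₁ · (L₀ ∗ w²)(x)`. [folklore] -/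
theorem oddSym_sq_logLoc_le (x : EuclideanSpace ℝ (Fin 2)) :
    (∫ y, (ball (0 : EuclideanSpace ℝ (Fin 2)) 1).indicator (fun z => -Real.log ‖z‖) (x - y) * |w y|) ^ 2 ≤
      (∫ z, (ball (0 : EuclideanSpace ℝ (Fin 2)) 1).indicator (fun z => -Real.log ‖z‖) z) *
        ∫ y, w y ^ 2 * (ball (0 : EuclideanSpace ℝ (Fin 2)) 1).indicator (fun z => -Real.log ‖z‖) (x - y) := by
  set g : EuclideanSpace ℝ (Fin 2) → ℝ := fun y =>
    (ball (0 : EuclideanSpace ℝ (Fin 2)) 1).indicator (fun z => -Real.log ‖z‖) (x - y) with hg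
  have hg0 : ∀ y, 0 ≤ g y := fun y => indicator_neg_log_norm_nonneg _
  have hgi : Integrable g := integrable_indicator_neg_log_norm.comp_sub_left x
  have hgm : AEStronglyMeasurable g volume := hgi.aestronglyMeasurable
  obtain ⟨-, hgb⟩ := oddSym_integrable_logLoc_mul hw hwc x
  have hga : Integrable (fun y => g y * (1 : ℝ) ^ 2) := by simpa using hgi
  have hgb' : Integrable (fun y => g y * |w y| ^ 2) :=
    hgb.congr (Eventually.of_forall fun y => by simp only [hg, sq_abs]; ring)
  obtain ⟨-, hcs⟩ := abs_integral_weight_mul_mul_le (μ := volume) (a := fun _ => (1 : ℝ)) (b := fun y => |w y|)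
    hg0 hgm aestronglyMeasurable_const (continuous_abs.comp hw).aestronglyMeasurable hga hgb'
  have e1 : ∫ y, g y * ((1 : ℝ) * |w y|) = ∫ y, g y * |w y| :=
    integral_congr_ae (Eventually.of_forall fun y => by ring)
  have e2 : ∫ y, g y * (1 : ℝ) ^ 2 = ∫ z, (ball (0 : EuclideanSpace ℝ (Fin 2)) 1).indicator (fun z => -Real.log ‖z‖) z := by
    simp only [hg, one_pow, mul_one]
    exact integral_sub_left_eq_self _ volume x
  have e3 : ∫ y, g y * |w y| ^ 2 = ∫ y, w y ^ 2 * g y :=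
    integral_congr_ae (Eventually.of_forall fun y => by simp only [sq_abs]; ring)
  rw [e1, e2, e3] at hcs
  have hA0 : 0 ≤ ∫ y, g y * |w y| := integral_nonneg fun y => mul_nonneg (hg0 y) (abs_nonneg _)
  have hI0 : 0 ≤ ∫ z, (ball (0 : EuclideanSpace ℝ (Fin 2)) 1).indicator (fun z => -Real.log ‖z‖) z :=
    integral_nonneg indicator_neg_log_norm_nonneg
  have hB0 : 0 ≤ ∫ y, w y ^ 2 * g y := integral_nonneg fun y => mul_nonneg (sq_nonneg _) (hg0 y)
  rw [abs_of_nonneg hA0] at hcs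
  calc (∫ y, g y * |w y|) ^ 2 ≤ (Real.sqrt (∫ z, (ball (0 : EuclideanSpace ℝ (Fin 2)) 1).indicator
        (fun z => -Real.log ‖z‖) z) * Real.sqrt (∫ y, w y ^ 2 * g y)) ^ 2 := pow_le_pow_left₀ hA0 hcs 2
    _ = _ := by rw [mul_pow, Real.sq_sqrt hI0, Real.sq_sqrt hB0]

include hw hwc hψ in
/-- **`ψ² ≤ 3(2π)⁻² (‖L₀‖₁ (L₀ ∗ w²) + (1 + |x|)² ‖w‖₁² + (∫|y||w|)²)`**. [folklore] -/
theorem oddSym_psi_sq_le (x : EuclideanSpace ℝ (Fin 2)) :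
    ψ x ^ 2 ≤ 3 * (2 * Real.pi)⁻¹ ^ 2 *
      ((∫ z, (ball (0 : EuclideanSpace ℝ (Fin 2)) 1).indicator (fun z => -Real.log ‖z‖) z) *
          (∫ y, w y ^ 2 * (ball (0 : EuclideanSpace ℝ (Fin 2)) 1).indicator (fun z => -Real.log ‖z‖) (x - y)) +
        (1 + ‖x‖) ^ 2 * (∫ y, |w y|) ^ 2 + (∫ y, ‖y‖ * |w y|) ^ 2) := by
  have h1 := oddSym_abs_psi_le hw hwc hψ x
  have h2 := oddSym_sq_logLoc_le hw hwc x
  set A := ∫ y, (ball (0 : EuclideanSpace ℝ (Fin 2)) 1).indicator (fun z => -Real.log ‖z‖) (x - y) * |w y|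
  set n₁ := ∫ y, |w y|
  set m₁ := ∫ y, ‖y‖ * |w y|
  have hn₁ : 0 ≤ n₁ := integral_nonneg fun y => abs_nonneg _
  have hlog0 : 0 ≤ Real.log (1 + ‖x‖) := Real.log_nonneg (by linarith [norm_nonneg x])
  have hlog : Real.log (1 + ‖x‖) ≤ 1 + ‖x‖ := by
    have := Real.log_le_sub_one_of_pos (by positivity : (0:ℝ) < 1 + ‖x‖); linarith
  have h3 : |ψ x| ^ 2 ≤ ((2 * Real.pi)⁻¹ * (A + Real.log (1 + ‖x‖) * n₁ + m₁)) ^ 2 :=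
    pow_le_pow_left₀ (abs_nonneg _) h1 2
  rw [sq_abs] at h3
  have h4 : (A + Real.log (1 + ‖x‖) * n₁ + m₁) ^ 2 ≤ 3 * (A ^ 2 + (Real.log (1 + ‖x‖) * n₁) ^ 2 + m₁ ^ 2) := by
    nlinarith [sq_nonneg (A - Real.log (1 + ‖x‖) * n₁), sq_nonneg (A - m₁), sq_nonneg (Real.log (1 + ‖x‖) * n₁ - m₁)]
  have h5 : (Real.log (1 + ‖x‖) * n₁) ^ 2 ≤ (1 + ‖x‖) ^ 2 * n₁ ^ 2 := by
    rw [mul_pow]; exact mul_le_mul_of_nonneg_right (pow_le_pow_left₀ hlog0 hlog 2) (sq_nonneg _)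
  have hc : (0:ℝ) ≤ (2 * Real.pi)⁻¹ ^ 2 := sq_nonneg _
  calc ψ x ^ 2 ≤ ((2 * Real.pi)⁻¹ * (A + Real.log (1 + ‖x‖) * n₁ + m₁)) ^ 2 := h3
    _ = (2 * Real.pi)⁻¹ ^ 2 * (A + Real.log (1 + ‖x‖) * n₁ + m₁) ^ 2 := by ring
    _ ≤ (2 * Real.pi)⁻¹ ^ 2 * (3 * (A ^ 2 + (Real.log (1 + ‖x‖) * n₁) ^ 2 + m₁ ^ 2)) :=
        mul_le_mul_of_nonneg_left h4 hc
    _ ≤ (2 * Real.pi)⁻¹ ^ 2 * (3 * ((∫ z, (ball (0 : EuclideanSpace ℝ (Fin 2)) 1).indicator (fun z => -Real.log ‖z‖) z) *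
          (∫ y, w y ^ 2 * (ball (0 : EuclideanSpace ℝ (Fin 2)) 1).indicator (fun z => -Real.log ‖z‖) (x - y)) +
          (1 + ‖x‖) ^ 2 * n₁ ^ 2 + m₁ ^ 2)) := by
        gcongr
    _ = _ := by ring

end PsiPointwise

/-! ### Weighted integrals of `ψ²` and `|∇ψ|²` against a bounded integrable weight -/

section Weighted

variable {m : EuclideanSpace ℝ (Fin 2) → ℝ} {Hm : ℝ} (hmm : AEStronglyMeasurable m volume)
  (hm0 : ∀ x, 0 ≤ m x) (hmH : ∀ x, m x ≤ Hm) (hmi : Integrable m)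

include hmm hm0 hmH hmi in
/-- **`∫ m ψ² ≤ 3(2π)⁻² (‖L₀‖₁² H ‖w‖₂² + ‖w‖₁² ∫ m(1+|x|)² + (∫|y||w|)² ∫ m)`** for a weight
`0 ≤ m ≤ H` with `m`, `m(1+|x|)²` integrable (`∫ L₀ ∗ w² = ‖L₀‖₁‖w‖₂²`). [folklore] -/
theorem oddSym_integral_weight_mul_psi_sq_le (hmi2 : Integrable fun x => m x * (1 + ‖x‖) ^ 2)
    {w ψ : EuclideanSpace ℝ (Fin 2) → ℝ} (hw : Continuous w) (hwc : HasCompactSupport w) (hψc : Continuous ψ)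
    (hψ : ∀ x, ψ x = ∫ y, (2 * Real.pi)⁻¹ * Real.log ‖x - y‖ * w y) :
    Integrable (fun x => m x * ψ x ^ 2) ∧
    ∫ x, m x * ψ x ^ 2 ≤ 3 * (2 * Real.pi)⁻¹ ^ 2 *
      ((∫ z, (ball (0 : EuclideanSpace ℝ (Fin 2)) 1).indicator (fun z => -Real.log ‖z‖) z) ^ 2 * Hm * (∫ y, w y ^ 2) +
        (∫ y, |w y|) ^ 2 * (∫ x, m x * (1 + ‖x‖) ^ 2) + (∫ y, ‖y‖ * |w y|) ^ 2 * ∫ x, m x) := by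
  set L₀ : EuclideanSpace ℝ (Fin 2) → ℝ := (ball (0 : EuclideanSpace ℝ (Fin 2)) 1).indicator (fun z => -Real.log ‖z‖) with hL₀
  set I₀ : ℝ := ∫ z, L₀ z with hI₀
  set n₁ : ℝ := ∫ y, |w y|
  set m₁ : ℝ := ∫ y, ‖y‖ * |w y|
  have hI₀0 : 0 ≤ I₀ := integral_nonneg indicator_neg_log_norm_nonneg
  have hHm : 0 ≤ Hm := (hm0 0).trans (hmH 0)
  have hwc2 : HasCompactSupport (fun y => w y ^ 2) := hwc.mono fun y hy => by simpa using hy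
  have hw2 : Integrable fun y => w y ^ 2 := (hw.pow 2).integrable_of_hasCompactSupport hwc2
  -- `B = w² ∗ L₀`
  set B : EuclideanSpace ℝ (Fin 2) → ℝ := fun x => ∫ y, w y ^ 2 * L₀ (x - y) with hB
  have hB_eq : B = MeasureTheory.convolution (fun y => w y ^ 2) L₀ (ContinuousLinearMap.mul ℝ ℝ) volume := by
    ext x; rw [convolution_mul]
  have hBi : Integrable B := by rw [hB_eq]; exact hw2.integrable_convolution _ integrable_indicator_neg_log_norm
  have hB_int : ∫ x, B x = (∫ y, w y ^ 2) * I₀ := by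
    rw [hB_eq, integral_convolution _ hw2 integrable_indicator_neg_log_norm, ContinuousLinearMap.mul_apply']
  have hB0 : ∀ x, 0 ≤ B x := fun x => integral_nonneg fun y => mul_nonneg (sq_nonneg _) (indicator_neg_log_norm_nonneg _)
  -- the integrable majorant
  set F : EuclideanSpace ℝ (Fin 2) → ℝ := fun x => 3 * (2 * Real.pi)⁻¹ ^ 2 *
    (I₀ * Hm * B x + n₁ ^ 2 * (m x * (1 + ‖x‖) ^ 2) + m₁ ^ 2 * m x) with hF
  have hF1 : Integrable fun x => I₀ * Hm * B x := hBi.const_mul _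
  have hF2 : Integrable fun x => n₁ ^ 2 * (m x * (1 + ‖x‖) ^ 2) := hmi2.const_mul _
  have hF3 : Integrable fun x => m₁ ^ 2 * m x := hmi.const_mul _
  have hF12 : Integrable fun x => I₀ * Hm * B x + n₁ ^ 2 * (m x * (1 + ‖x‖) ^ 2) := hF1.add hF2
  have hFi : Integrable F := (hF12.add hF3).const_mul _
  have hpt : ∀ x, m x * ψ x ^ 2 ≤ F x := fun x => by
    have h1 := oddSym_psi_sq_le hw hwc hψ x
    have h2 : m x * (I₀ * B x) ≤ Hm * (I₀ * B x) := mul_le_mul_of_nonneg_right (hmH x) (mul_nonneg hI₀0 (hB0 x))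
    calc m x * ψ x ^ 2 ≤ m x * (3 * (2 * Real.pi)⁻¹ ^ 2 * (I₀ * B x + (1 + ‖x‖) ^ 2 * n₁ ^ 2 + m₁ ^ 2)) :=
          mul_le_mul_of_nonneg_left h1 (hm0 x)
      _ = 3 * (2 * Real.pi)⁻¹ ^ 2 * (m x * (I₀ * B x) + n₁ ^ 2 * (m x * (1 + ‖x‖) ^ 2) + m₁ ^ 2 * m x) := by ring
      _ ≤ 3 * (2 * Real.pi)⁻¹ ^ 2 * (Hm * (I₀ * B x) + n₁ ^ 2 * (m x * (1 + ‖x‖) ^ 2) + m₁ ^ 2 * m x) := by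
          gcongr
      _ = F x := by simp only [hF]; ring
  have hmeas : AEStronglyMeasurable (fun x => m x * ψ x ^ 2) volume := hmm.mul (hψc.pow 2).aestronglyMeasurable
  have hInt : Integrable (fun x => m x * ψ x ^ 2) :=
    hFi.mono' hmeas (Eventually.of_forall fun x => by
      rw [Real.norm_of_nonneg (mul_nonneg (hm0 x) (sq_nonneg _))]; exact hpt x)
  refine ⟨hInt, ?_⟩
  calc ∫ x, m x * ψ x ^ 2 ≤ ∫ x, F x := integral_mono hInt hFi hpt
    _ = 3 * (2 * Real.pi)⁻¹ ^ 2 * (I₀ * Hm * ((∫ y, w y ^ 2) * I₀) + n₁ ^ 2 * (∫ x, m x * (1 + ‖x‖) ^ 2) +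
          m₁ ^ 2 * ∫ x, m x) := by
        simp only [hF]
        rw [integral_const_mul, integral_add hF12 hF3, integral_add hF1 hF2, integral_const_mul, integral_const_mul,
          integral_const_mul, hB_int]
    _ = _ := by ring

include hmm hm0 hmH hmi in
/-- **`∫ m |∇ψ|² ≤ C_Y (H ‖w‖₂² + ‖w‖₁² ∫ m)`** for a weight `0 ≤ m ≤ H`, `m ∈ L¹`: `|∇ψ| = |K ∗ w|`
(tools A) and the Young-type bound of `…StubBiotSavartYoung` with `h = √m`. [folklore] -/
theorem oddSym_integral_weight_mul_norm_fderiv_psi_sq_le {CY : ℝ}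
    (hY : ∀ (w h : EuclideanSpace ℝ (Fin 2) → ℝ) (H : ℝ), Continuous w → Integrable w →
      Integrable (fun η => w η ^ 2) → AEStronglyMeasurable h volume → (∀ ξ, |h ξ| ≤ H) →
      Integrable (fun ξ => h ξ ^ 2) →
      Integrable (fun ξ => ‖biotSavart2D w ξ‖ ^ 2 * h ξ ^ 2) ∧
        ∫ ξ, ‖biotSavart2D w ξ‖ ^ 2 * h ξ ^ 2 ≤ CY * (H ^ 2 * (∫ η, w η ^ 2) + (∫ η, |w η|) ^ 2 * ∫ ξ, h ξ ^ 2))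
    {w ψ : EuclideanSpace ℝ (Fin 2) → ℝ} (hw : ContDiff ℝ 2 w) (hwc : HasCompactSupport w)
    (hψ : ∀ x, ψ x = ∫ y, (2 * Real.pi)⁻¹ * Real.log ‖x - y‖ * w y) :
    Integrable (fun x => m x * ‖fderiv ℝ ψ x‖ ^ 2) ∧
    ∫ x, m x * ‖fderiv ℝ ψ x‖ ^ 2 ≤ CY * (Hm * (∫ y, w y ^ 2) + (∫ y, |w y|) ^ 2 * ∫ x, m x) := by
  have hHm : 0 ≤ Hm := (hm0 0).trans (hmH 0)
  have hwi : Integrable w := hw.continuous.integrable_of_hasCompactSupport hwc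
  have hwc2 : HasCompactSupport (fun y => w y ^ 2) := hwc.mono fun y hy => by simpa using hy
  have hw2 : Integrable fun y => w y ^ 2 := (hw.continuous.pow 2).integrable_of_hasCompactSupport hwc2
  set h : EuclideanSpace ℝ (Fin 2) → ℝ := fun x => Real.sqrt (m x) with hh
  have hh2 : ∀ x, h x ^ 2 = m x := fun x => Real.sq_sqrt (hm0 x)
  have hhm : AEStronglyMeasurable h volume := Real.continuous_sqrt.comp_aestronglyMeasurable hmm
  have hhH : ∀ x, |h x| ≤ Real.sqrt Hm := fun x => by
    rw [abs_of_nonneg (Real.sqrt_nonneg _)]; exact Real.sqrt_le_sqrt (hmH x)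
  have hh2i : Integrable fun x => h x ^ 2 := hmi.congr (Eventually.of_forall fun x => (hh2 x).symm)
  obtain ⟨hI, hle⟩ := hY w h (Real.sqrt Hm) hw.continuous hwi hw2 hhm hhH hh2i
  have heq : (fun x => m x * ‖fderiv ℝ ψ x‖ ^ 2) = fun x => ‖biotSavart2D w x‖ ^ 2 * h x ^ 2 := by
    funext x; rw [hh2, oddSym_norm_biotSavart2D_eq hw hwc hψ x, mul_comm]
  have hint2 : ∫ x, h x ^ 2 = ∫ x, m x := integral_congr_ae (Eventually.of_forall hh2)
  rw [heq]
  refine ⟨hI, hle.trans (le_of_eq ?_)⟩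
  rw [Real.sq_sqrt hHm, hint2]

end Weighted

/-! ### The registered sub-stub -/

/-- **Sub-stub `stub_oddSymmetrizerBoundsToolsD` of crux stmt-NavierStokesRegularity-17973, line
`Sketch`** (tools for `stub_oddSymmetrizerBounds`): `X_λ`-control of `‖w‖₁`, `∫|y||w|`, `‖w‖₂`, and the
weighted bounds of `∫ m ψ²`, `∫ m |∇ψ|²` (`ψ = N ∗ w`) for a bounded integrable weight `m`. [folklore] -/
theorem stub_oddSymmetrizerBoundsToolsD :
    (∀ (lam : ℝ), lam < 1 → ∀ (w : EuclideanSpace ℝ (Fin 2) → ℝ), Continuous w →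
      Integrable (fun x => (gaussWeightLam lam x)⁻¹ * w x ^ 2) →
      (∫ x, |w x|) ^ 2 ≤ ∫ x, (gaussWeightLam lam x)⁻¹ * w x ^ 2 ∧
      (∫ x, ‖x‖ * |w x|) ^ 2 ≤ (∫ x : EuclideanSpace ℝ (Fin 2), ‖x‖ ^ 2 * gaussWeightLam lam x) *
        ∫ x, (gaussWeightLam lam x)⁻¹ * w x ^ 2 ∧
      (Integrable (fun x => w x ^ 2) →
        ∫ x, w x ^ 2 ≤ (1 - lam) / (4 * Real.pi) * ∫ x, (gaussWeightLam lam x)⁻¹ * w x ^ 2)) ∧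
    (∀ (m : EuclideanSpace ℝ (Fin 2) → ℝ) (Hm : ℝ), AEStronglyMeasurable m volume → (∀ x, 0 ≤ m x) →
      (∀ x, m x ≤ Hm) → Integrable m → Integrable (fun x => m x * (1 + ‖x‖) ^ 2) →
      ∀ (w ψ : EuclideanSpace ℝ (Fin 2) → ℝ), Continuous w → HasCompactSupport w → Continuous ψ →
      (∀ x, ψ x = ∫ y, (2 * Real.pi)⁻¹ * Real.log ‖x - y‖ * w y) →
      Integrable (fun x => m x * ψ x ^ 2) ∧
      ∫ x, m x * ψ x ^ 2 ≤ 3 * (2 * Real.pi)⁻¹ ^ 2 *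
        ((∫ z, (Metric.ball (0 : EuclideanSpace ℝ (Fin 2)) 1).indicator (fun z => -Real.log ‖z‖) z) ^ 2 * Hm * (∫ y, w y ^ 2) +
          (∫ y, |w y|) ^ 2 * (∫ x, m x * (1 + ‖x‖) ^ 2) + (∫ y, ‖y‖ * |w y|) ^ 2 * ∫ x, m x)) ∧
    (∀ (CY : ℝ), (∀ (w h : EuclideanSpace ℝ (Fin 2) → ℝ) (H : ℝ), Continuous w → Integrable w →
        Integrable (fun η => w η ^ 2) → AEStronglyMeasurable h volume → (∀ ξ, |h ξ| ≤ H) →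
        Integrable (fun ξ => h ξ ^ 2) →
        Integrable (fun ξ => ‖biotSavart2D w ξ‖ ^ 2 * h ξ ^ 2) ∧
          ∫ ξ, ‖biotSavart2D w ξ‖ ^ 2 * h ξ ^ 2 ≤ CY * (H ^ 2 * (∫ η, w η ^ 2) + (∫ η, |w η|) ^ 2 * ∫ ξ, h ξ ^ 2)) →
      ∀ (m : EuclideanSpace ℝ (Fin 2) → ℝ) (Hm : ℝ), AEStronglyMeasurable m volume → (∀ x, 0 ≤ m x) →
      (∀ x, m x ≤ Hm) → Integrable m →
      ∀ (w ψ : EuclideanSpace ℝ (Fin 2) → ℝ), ContDiff ℝ 2 w → HasCompactSupport w →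
      (∀ x, ψ x = ∫ y, (2 * Real.pi)⁻¹ * Real.log ‖x - y‖ * w y) →
      Integrable (fun x => m x * ‖fderiv ℝ ψ x‖ ^ 2) ∧
      ∫ x, m x * ‖fderiv ℝ ψ x‖ ^ 2 ≤ CY * (Hm * (∫ y, w y ^ 2) + (∫ y, |w y|) ^ 2 * ∫ x, m x)) :=
  ⟨fun _ hlam _ hw hwX => ⟨oddSym_sq_integral_abs_le hlam hw hwX, oddSym_sq_integral_norm_mul_abs_le hlam hw hwX,
      fun hw2 => oddSym_integral_sq_le hlam hw2 hwX⟩,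
    fun _ _ hmm hm0 hmH hmi hmi2 _ _ hw hwc hψc hψ =>
      oddSym_integral_weight_mul_psi_sq_le hmm hm0 hmH hmi hmi2 hw hwc hψc hψ,
    fun _ hY _ _ hmm hm0 hmH hmi _ _ hw hwc hψ =>
      oddSym_integral_weight_mul_norm_fderiv_psi_sq_le hmm hm0 hmH hmi hY hw hwc hψ⟩

end Summit.NavierStokesRegularity.NavierStokesRegularity.Theorems
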